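import Summits.BirchSwinnertonDyer.BirchSwinnertonDyer.Theorems.ManinLocalTwoThreeBracketSturmEighty
import HarnessLib

/-!
# The two ROOT FORMS of level 80 as DATUM-FREE TERMS: `φ₈₀ₐ = C₅ − C₇′`, `φ₈₀ᵦ = C₅ + C₇′ ∈ S₂(Γ₀(80))`, their tables and Néron squeezes

Cell bsd-f2-manin, route `ManinLocalTwoThree` (crux C2 `ManinOddAtFour`, stmt-BirchSwinnertonDyer-22967; `--supports` helper), LEAD p1 gen 26.
p2's LEVEL-80 certificate (`…BracketSturmEighty`) proves `|c| = 1` for every `X₀(80)`-DATUM whose newform has the function `C₅ ∓ C₇′`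
(`abs_maninConstant_eq_one_eighty_of_pinnedA/B`, hypothesis `hf : ⇑D.f = …`).  The twist-transport capstones of HIGHER levels rooted at `80`
(kernel census, LEAD-MEMO v44 §6: `400a = 80b ⊗ χ₅`, `400e = 80a ⊗ χ₅` by p3's odd-twist root-form transport at `p = 5` once an's level-400 pinning
lands; the pattern of `…ManinConstantTwoHundredC`) need the roots as TERMS `f₀ : CuspForm (Gamma0 80) 2` with (i) a certified coefficient table and
(ii) the squeeze `Λ(f₀) ⊆ Λ_Néron(W₀)` for a Néron period pair of the root curve — not a statement about data.  This file supplies exactly that,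
re-instantiating p2's kernel certificates (no new certificate is computed):

* §1 `CFive`, `CSevenS` (the `η`-quotient cusp forms of `LevelEighty.etaCert_C5 / etaCert_C7s`), **`phiEightyA := CFive + (−1)•CSevenS`**,
  **`phiEightyB := CFive + (1)•CSevenS`**, their functions `coe_phiEightyA/B` (literally the `hf` of p2's theorems), the tables `tEightyA/B` to depth
  `145` as `cuspCoeff` (`tEightyA_eq_cuspCoeff`, `tEightyB_eq_cuspCoeff`, from `LevelEighty.exists_formF_eightyA/B`), `phiEightyA/B_ne_zero`.
* §2 **`periodLattice_le_phiEightyA (L₀) (hL₀ : IsNeronLatticeOf (80a1/ℂ) L₀) : ∀ z ∈ periodLattice phiEightyA, z ∈ L₀.lattice`** (`80a1 = [0,0,0,−7,6]`)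
  and **`periodLattice_le_phiEightyB`** (`80b1 = [0,−1,0,4,−4]`): p2's `defectList_eq_eightyA/B`, `hBnz/hCnz`, `exists_formsAB_eightyA/B`, `sturm_eighty`
  fed to `BracketSturm.defectForm_coeff_eq_zero_of_defectList` + `modularForm_eq_zero_of_coeff_eq_zero` + `periodLattice_le_of_defectForm_eq_zero`.

HONEST FRAMING: unconditional (standard axioms); bookkeeping for future capstones (levels `400`, `320`, …); nothing here proves C2/C3, Manin's conjecture
or BSD.  The `List ℤ` tables are data; no `Prop` definition, no named fact, no sorry. [cite: Sturm1987, Thm. 1] [cite: CremonaAlgorithms1997, §2.10, Table 1 (80a1, 80b1)]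
[cite: Ligozat1975, Ch. 3]
-/

set_option autoImplicit false
-- lint-debt: the directory name repeats the summit name (sibling precedent `ManinLocalTwoThreeRootFormsOneNinetyTwo.lean`)
set_option linter.dupNamespace false

noncomputable section

open Complex
open UpperHalfPlane hiding I
open scoped MatrixGroups ModularForm
open ModularForm CongruenceSubgroup PowerSeries
open Literature.NumberTheory.ModularForms
open Literature.NumberTheory.EllipticCurves Literature.NumberTheory.EllipticCurves.ModularForms

namespace Summit.BirchSwinnertonDyer.BirchSwinnertonDyer.Theorems.ManinLocalTwoThree.RootFormsEighty

open Summit.BirchSwinnertonDyer.BirchSwinnertonDyer.Theorems.ManinLocalTwoThree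
open BracketSturm LevelEighty

set_option maxHeartbeats 4000000
set_option maxRecDepth 16384

/-! ## §1 The terms `φ₈₀ₐ`, `φ₈₀ᵦ`, their functions and tables -/

/-- **`C₅ = η₄²η₈η₁₀η₂₀²/(η₂η₄₀) ∈ S₂(Γ₀(80))`** as a term (p2's Ligozat certificate `etaCert_C5`). [cite: Ligozat1975, Ch. 3] -/
def CFive : CuspForm (Gamma0 80) 2 :=
  etaQuotientCuspForm 80 (expFn [(2, -1), (4, 2), (8, 1), (10, 1), (20, 2), (40, -1)]) 2 (by decide) (newmanCond_of_etaCert etaCert_C5) etaCert_C5.2.2.2.2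

/-- **`C₇′ = η₂η₄²η₂₀²η₄₀/(η₈η₁₀) ∈ S₂(Γ₀(80))`** as a term (p2's Ligozat certificate `etaCert_C7s`). [cite: Ligozat1975, Ch. 3] -/
def CSevenS : CuspForm (Gamma0 80) 2 :=
  etaQuotientCuspForm 80 (expFn [(2, 1), (4, 2), (8, -1), (10, -1), (20, 2), (40, 1)]) 2 (by decide) (newmanCond_of_etaCert etaCert_C7s) etaCert_C7s.2.2.2.2

/-- **`φ₈₀ₐ := C₅ − C₇′`**, the newform `80a` as a DATUM-FREE cusp form of level `80`. [cite: CremonaAlgorithms1997, Table 3 (N = 80)] -/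
def phiEightyA : CuspForm (Gamma0 80) 2 := CFive + (-1 : ℂ) • CSevenS

/-- **`φ₈₀ᵦ := C₅ + C₇′`**, the newform `80b` as a DATUM-FREE cusp form of level `80`. [cite: CremonaAlgorithms1997, Table 3 (N = 80)] -/
def phiEightyB : CuspForm (Gamma0 80) 2 := CFive + (1 : ℂ) • CSevenS

/-- The function of `φ₈₀ₐ` — literally the hypothesis `hf` of `LevelEighty.abs_maninConstant_eq_one_eighty_of_pinnedA`. [folklore] -/
theorem coe_phiEightyA : ⇑phiEightyA = (fun τ ↦ etaQuotient 80 (expFn [(2, -1), (4, 2), (8, 1), (10, 1), (20, 2), (40, -1)]) τ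
    - etaQuotient 80 (expFn [(2, 1), (4, 2), (8, -1), (10, -1), (20, 2), (40, 1)]) τ) := by
  funext τ
  simp only [phiEightyA, CuspForm.coe_add, Pi.add_apply, CuspForm.IsGLPos.smul_apply, smul_eq_mul, CFive, CSevenS, coe_etaQuotientCuspForm]
  ring

/-- The function of `φ₈₀ᵦ` — literally the hypothesis `hf` of `LevelEighty.abs_maninConstant_eq_one_eighty_of_pinnedB`. [folklore] -/
theorem coe_phiEightyB : ⇑phiEightyB = (fun τ ↦ etaQuotient 80 (expFn [(2, -1), (4, 2), (8, 1), (10, 1), (20, 2), (40, -1)]) τ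
    + etaQuotient 80 (expFn [(2, 1), (4, 2), (8, -1), (10, -1), (20, 2), (40, 1)]) τ) := by
  funext τ
  simp only [phiEightyB, CuspForm.coe_add, Pi.add_apply, CuspForm.IsGLPos.smul_apply, smul_eq_mul, CFive, CSevenS, coe_etaQuotientCuspForm]
  ring

/-- Coefficient table of `φ₈₀ₐ` (`= aₙ(80a) = χ₋₄(n)·aₙ(40a)`) to depth `145` — literally the table of `LevelEighty.exists_formF_eightyA`. [cite: CremonaAlgorithms1997, Table 3 (N = 80)] -/
def tEightyA : List ℤ :=
  [0, 1, 0, 0, 0, 1, 0, 4, 0, -3, 0, -4, 0, -2, 0, 0, 0, 2, 0, -4, 0, 0, 0, -4, 0, 1, 0, 0, 0, -2, 0, 8, 0, 0, 0, 4, 0, 6, 0, 0, 0, -6, 0, 8, 0, -3, 0, -4,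
  0, 9, 0, 0, 0, 6, 0, -4, 0, 0, 0, 4, 0, -2, 0, -12, 0, -2, 0, -8, 0, 0, 0, 0, 0, -6, 0, 0, 0, -16, 0, 0, 0, 9, 0, 16, 0, 2, 0, 0, 0, -6, 0, -8, 0, 0, 0,
  -4, 0, -14, 0, 12, 0, 6, 0, -4, 0, 0, 0, 0, 0, 14, 0, 0, 0, 18, 0, -4, 0, 6, 0, 8, 0, 5, 0, 0, 0, 1, 0, 12, 0, 0, 0, -12, 0, -16, 0, 0, 0, 10, 0, -12, 0,
  0, 0, 8, 0]

/-- Coefficient table of `φ₈₀ᵦ` (`= aₙ(80b) = χ₋₄(n)·aₙ(20a)`) to depth `145` — literally the table of `LevelEighty.exists_formF_eightyB`. [cite: CremonaAlgorithms1997, Table 3 (N = 80)] -/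
def tEightyB : List ℤ :=
  [0, 1, 0, 2, 0, -1, 0, -2, 0, 1, 0, 0, 0, 2, 0, -2, 0, -6, 0, 4, 0, -4, 0, -6, 0, 1, 0, -4, 0, 6, 0, 4, 0, 0, 0, 2, 0, 2, 0, 4, 0, 6, 0, 10, 0, -1, 0, 6,
  0, -3, 0, -12, 0, -6, 0, 0, 0, 8, 0, -12, 0, 2, 0, -2, 0, -2, 0, -2, 0, -12, 0, 12, 0, 2, 0, 2, 0, 0, 0, -8, 0, -11, 0, -6, 0, 6, 0, 12, 0, -6, 0, -4, 0,
  8, 0, -4, 0, 2, 0, 0, 0, 6, 0, -14, 0, 4, 0, 6, 0, 2, 0, 4, 0, -6, 0, 6, 0, 2, 0, 12, 0, -11, 0, 12, 0, -1, 0, -2, 0, 20, 0, 0, 0, -8, 0, 4, 0, 18, 0, 4,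
  0, 12, 0, 0, 0]

/-- **`aₙ(φ₈₀ₐ) = tEightyA[n]`, `n < 145`** (p2's table of `C₅ − C₇′`, transported along `coe_phiEightyA`). [cite: Koehler2011, §2.1] -/
theorem tEightyA_eq_cuspCoeff : ∀ n < 145, ((tEightyA.getD n 0 : ℤ) : ℂ) = cuspCoeff phiEightyA n := by
  obtain ⟨F, hF, hFcoe⟩ := exists_formF_eightyA
  exact coeff_eq_of_coe_eq (coe_phiEightyA.trans hFcoe.symm) hF

/-- **`aₙ(φ₈₀ᵦ) = tEightyB[n]`, `n < 145`.** [cite: Koehler2011, §2.1] -/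
theorem tEightyB_eq_cuspCoeff : ∀ n < 145, ((tEightyB.getD n 0 : ℤ) : ℂ) = cuspCoeff phiEightyB n := by
  obtain ⟨F, hF, hFcoe⟩ := exists_formF_eightyB
  exact coeff_eq_of_coe_eq (coe_phiEightyB.trans hFcoe.symm) hF

/-- `φ₈₀ₐ ≠ 0` (`a₁ = 1`). [folklore] -/
theorem phiEightyA_ne_zero : phiEightyA ≠ 0 := by
  intro h
  have h1 := tEightyA_eq_cuspCoeff 1 (by norm_num)
  have ht : tEightyA.getD 1 0 = 1 := by decide
  rw [ht, h, show cuspCoeff (0 : CuspForm (Gamma0 80) 2) 1 = 0 from by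
    change (qExpansion 1 ⇑(0 : CuspForm (Gamma0 80) 2)).coeff 1 = 0
    rw [CuspForm.coe_zero, UpperHalfPlane.qExpansion_zero]; simp] at h1
  norm_num at h1

/-- `φ₈₀ᵦ ≠ 0` (`a₁ = 1`). [folklore] -/
theorem phiEightyB_ne_zero : phiEightyB ≠ 0 := by
  intro h
  have h1 := tEightyB_eq_cuspCoeff 1 (by norm_num)
  have ht : tEightyB.getD 1 0 = 1 := by decide
  rw [ht, h, show cuspCoeff (0 : CuspForm (Gamma0 80) 2) 1 = 0 from by
    change (qExpansion 1 ⇑(0 : CuspForm (Gamma0 80) 2)).coeff 1 = 0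
    rw [CuspForm.coe_zero, UpperHalfPlane.qExpansion_zero]; simp] at h1
  norm_num at h1

/-! ## §2 The Néron squeezes, re-instantiated from p2's kernel certificates -/

/-- **`Λ(φ₈₀ₐ) ⊆ Λ(L₀)` for every Néron period pair `L₀` of `80a1 = [0, 0, 0, −7, 6]`** (`g₂ = 28`, `g₃ = −24`; p2's weight-12 defect certificate of
class `80a` to depth `145`, Sturm bound `144 < 145`). [cite: Sturm1987, Thm. 1] [cite: CremonaAlgorithms1997, §2.10, Table 1 (80a1)] -/
theorem periodLattice_le_phiEightyA (L₀ : PeriodPair) (hL₀ : IsNeronLatticeOf ((⟨0, 0, 0, -7, 6⟩ : WeierstrassCurve ℚ).baseChange ℂ) L₀) :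
    ∀ z ∈ periodLattice phiEightyA, z ∈ L₀.lattice := by
  obtain ⟨hc₂, hc₃⟩ := neron_invariants_eightyA1 hL₀
  obtain ⟨A, B, hA, hB⟩ := exists_formsAB_eightyA
  obtain ⟨h0, hBne, hCne⟩ := defectForm_coeff_eq_zero_of_defectList A B phiEightyA L₀.g₂ L₀.g₃ _ _ _ hA hB tEightyA_eq_cuspCoeff
    216 864 (6048) (-5184) (by norm_num) (by norm_num) hc₂ hc₃ (forall_getD_eq_zero_of_eq_replicate defectList_eq_eightyA) hBnz_eightyA hCnz_eightyA
  exact periodLattice_le_of_defectForm_eq_zero phiEightyA phiEightyA_ne_zero L₀ A B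
    (modularForm_eq_zero_of_coeff_eq_zero _ h0 sturm_eighty) hBne hCne

/-- **`Λ(φ₈₀ᵦ) ⊆ Λ(L₀)` for every Néron period pair `L₀` of `80b1 = [0, −1, 0, 4, −4]`** (p2's weight-12 defect certificate of class `80b`).
[cite: Sturm1987, Thm. 1] [cite: CremonaAlgorithms1997, §2.10, Table 1 (80b1)] -/
theorem periodLattice_le_phiEightyB (L₀ : PeriodPair) (hL₀ : IsNeronLatticeOf ((⟨0, -1, 0, 4, -4⟩ : WeierstrassCurve ℚ).baseChange ℂ) L₀) :
    ∀ z ∈ periodLattice phiEightyB, z ∈ L₀.lattice := by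
  obtain ⟨hc₂, hc₃⟩ := neron_invariants_eightyB1 hL₀
  obtain ⟨A, B, hA, hB⟩ := exists_formsAB_eightyB
  obtain ⟨h0, hBne, hCne⟩ := defectForm_coeff_eq_zero_of_defectList A B phiEightyB L₀.g₂ L₀.g₃ _ _ _ hA hB tEightyB_eq_cuspCoeff
    216 864 (-3168) (2368) (by norm_num) (by norm_num) hc₂ hc₃ (forall_getD_eq_zero_of_eq_replicate defectList_eq_eightyB) hBnz_eightyB hCnz_eightyB
  exact periodLattice_le_of_defectForm_eq_zero phiEightyB phiEightyB_ne_zero L₀ A B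
    (modularForm_eq_zero_of_coeff_eq_zero _ h0 sturm_eighty) hBne hCne

end Summit.BirchSwinnertonDyer.BirchSwinnertonDyer.Theorems.ManinLocalTwoThree.RootFormsEighty

end
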